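import Summits.MatrixMultiplication.MatrixMultiplication.Theorems.AbelianSTPPCensusTAStatTwoMember

/-!
# Static t*-certificate: the k-member bucket-descent tree (data-free definitions + soundness of the node test)

Cell mm-stpp (rung F-M1).  Theory g11/g12's static t*-indexed linear certificate (`AbelianSTPPCensusTAStatDefs.lean`) reads the companions of
the maximal-volume member `l` through ONE density entry; its two-member sharpening (`AbelianSTPPCensusTAStatTwoMember.lean`) makes the member
realising `t*` explicit when `t*` lies strictly above `l`'s own bucket.  This file generalises that device to an EXACT case analysis on the
bucket structure of the companions — a finite tree, evaluated per order `M`: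
* a NODE is a set of explicit members (the maximal member `l` and `k − 1` companions, carried only through the aggregates
  `(gO, pO, vO, amin, amax, k)` = total gain / pair-product sum / volume of the explicit companions, the least and the largest of their
  smallest sizes, and the count) at a bucket `j`, with the guarantee that every NON-explicit member has `t = ab ≤ TB[j+1] − 1` and every explicit
  companion has `t ≥ TB[j]`;
* the node TEST (`testK`) is the two-member per-order test of `TAStat2M` (`c2W/c2A/c2B/c2E`) with the second member replaced by the aggregates,
  plus the four «budget already exceeded» escapes, the genuineness guard `amax ≤ t` and an explicit budget SOURCE (an explicit companion with
  smallest size `< t`, or `l` itself when `TB[j] ≤ t_l`, or — at the root only — the member realising `t*`);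
* if the test fails, the node SPLITS: either some non-explicit member lies in bucket `j` — its sorted shape is in the bucket's complete list
  `M2[j]`, and taking the EARLIEST listed such shape makes the enumeration of multisets canonical (`goI`: the child keeps the list suffix from that
  shape on) — or all non-explicit members lie below bucket `j` and the node DESCENDS to `j − 1` (same explicit set; the table row is read one
  bucket lower).  At the root strictly above `l`'s own bucket the descent case is impossible (`t*` is realised by a companion).
`treeK`/`goI`/`rootK`/`coverK` are the Bool checkers (fuel = additions + descents), `walk3` is `TAStat2M.walk2` with `coverK` as the fallback;
`testK_sound` is the arithmetic meaning of the node test.  The tree's soundness (an induction over the fuel with an explicit index set) is in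
`AbelianSTPPCensusTAStatKMemberSound.lean`.  Exact integer twin: seat calc/twomember/tastat7.py (vp-p2 g5).
WHAT THIS IS NOT: no statement about STPP families, orders or `ω` — Bool checks on shape data and their arithmetic meaning; nothing here is specific to a range or a `τ`.
-/

set_option linter.dupNamespace false
set_option autoImplicit false

namespace Summit.MatrixMultiplication.MatrixMultiplication.Theorems.TAStatKM

open TECert (vol us)
open TAStat (Entry e0 cover)
open TAStat2M (c2W c2A c2B c2E tiOK)
open ShapeCert (D)

/-! ## The node test -/

/-- Aggregates of the explicit companions of a node: `(gO, pO, vO, amin, amax, k)` = their total gain, total pair-product sum, total volume,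
the least and the largest of their smallest sizes, and the number of explicit members (with `l`). -/
abbrev Agg : Type := ℕ × ℕ × ℕ × ℕ × ℕ × ℕ

/-- the root aggregate: no explicit companion (`amin` = a value above every budget parameter) -/
def agg0 : Agg := (0, 0, 0, 1000000, 0, 1)

/-- add an explicit companion of sorted shape `m` (gain `gm`) to the aggregates -/
def addM (gm : ℕ) (A : Agg) (m : ℕ × ℕ × ℕ) : Agg :=
  (A.1 + gm, A.2.1 + us m, A.2.2.1 + vol m, min A.2.2.2.1 m.1, max A.2.2.2.2.1 m.1, A.2.2.2.2.2 + 1)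

/-- **Node test** at order `M` for the maximal member `l` = (gain `g`, pair-product sum `p`, volume `V`, excess `d`, smallest size `al`, least pair
product `tl`) with explicit-companion aggregates `A`, at a bucket with lower end `tbj`, budget parameter `t`, density entry `e`; `root` allows the
implicit budget source (the member realising `t*`).  U11-G form (guards: `3 ≤ t`, `V < t·p`, `amax ≤ t`, a source; then «budget exceeded» or `c2W`),
U11 cap, U14 cap at `l`, E3 cap at `l` (each with its «cap exceeded» escape). [original] -/
def testK (g p V d al tl : ℕ) (A : Agg) (tbj t M : ℕ) (e : Entry) (root : Bool) : Bool :=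
  (Nat.ble 3 t && Nat.blt V (t * p) && Nat.ble A.2.2.2.2.1 t &&
      (root || Nat.blt A.2.2.2.1 t || (Nat.ble tbj tl && Nat.blt al t)) &&
      (Nat.blt (t * M + (2 * t * t - 1)) ((t * p - V) + (t * A.2.1 - A.2.2.1)) || c2W g p V t A.1 A.2.1 A.2.2.1 M e)) ||
  Nat.blt (3 * M) (d + 2 * A.2.1) || c2A g d A.1 A.2.1 M e ||
  Nat.blt (3 * M) (3 * V + A.2.1) || c2B g V A.1 A.2.1 M e ||
  (Nat.blt M (2 * V) && Nat.blt (V * V / M + 3 * M) (4 * V + A.2.1)) || c2E g V A.1 A.2.1 M e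

/-- **Soundness of the node test.**  At order `M`, with `GR`, `R`, `W` the non-explicit members' total gain, pair-product sum and U11-G weight:
the density bounds `GR·pP ≤ gP·R`, `GR·wW ≤ gW·W`, the caps `2(pO + R) + d ≤ 3M`, `pO + R + 3V ≤ 3M`, `M < 2V → pO + R ≤ (⌊V²/M⌋ + 3M) − 4V`,
some companion at all (`1 ≤ pO + R`) and — under the test's guards — the Grynkiewicz budget `(t·p − V) + (t·pO − vO) + W ≤ t·M + (2t² − 1)` give
`g + gO + GR ≤ 10⁶·M`. [original] -/
theorem testK_sound {g p V d al tl : ℕ} {A : Agg} {tbj t M : ℕ} {e : Entry} {root : Bool}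
    (h : testK g p V d al tl A tbj t M e root = true)
    {GR R W : ℕ} (hpP : 1 ≤ e.2.1) (hwW : 1 ≤ e.2.2.2) (hpos : 1 ≤ A.2.1 + R)
    (hGP : GR * e.2.1 ≤ e.1 * R) (hGW : GR * e.2.2.2 ≤ e.2.2.1 * W)
    (hA : 2 * (A.2.1 + R) + d ≤ 3 * M) (hB : A.2.1 + R + 3 * V ≤ 3 * M)
    (hE : M < 2 * V → A.2.1 + R ≤ (V * V / M + 3 * M) - 4 * V)
    (hW : 3 ≤ t → V < t * p → A.2.2.2.2.1 ≤ t → (root = true ∨ A.2.2.2.1 < t ∨ (tbj ≤ tl ∧ al < t)) →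
      (t * p - V) + (t * A.2.1 - A.2.2.1) + W ≤ t * M + (2 * t * t - 1)) :
    g + A.1 + GR ≤ D * M := by
  simp only [testK, Bool.or_eq_true, Bool.and_eq_true, Nat.ble_eq, Nat.blt_eq] at h
  rcases h with (((((hw | hi1) | ha) | hi2) | hb) | hie) | hee
  · obtain ⟨⟨⟨⟨ht3, hVtp⟩, hamax⟩, hsrc⟩, hbw⟩ := hw
    have hsrc' : root = true ∨ A.2.2.2.1 < t ∨ (tbj ≤ tl ∧ al < t) := by
      rcases hsrc with (hr | hm) | hl
      · exact Or.inl hr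
      · exact Or.inr (Or.inl hm)
      · exact Or.inr (Or.inr hl)
    have hW' := hW ht3 hVtp hamax hsrc'
    rcases hbw with hover | hc
    · exfalso; omega
    · simp only [c2W, Nat.ble_eq] at hc
      have h1 : e.2.2.1 * ((t * p - V) + (t * A.2.1 - A.2.2.1)) + e.2.2.1 * W ≤ e.2.2.1 * (t * M + (2 * t * t - 1)) := by
        rw [← Nat.mul_add]; exact Nat.mul_le_mul_left _ hW'
      have key : (g + A.1 + GR) * e.2.2.2 ≤ D * M * e.2.2.2 := by
        rw [Nat.add_mul]
        omega
      exact Nat.le_of_mul_le_mul_right key hwW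
  · exfalso; omega
  · simp only [c2A, Nat.ble_eq] at ha
    have h1 : e.1 * (d + 2 * A.2.1) + e.1 * (2 * R) ≤ e.1 * (3 * M) := by
      rw [← Nat.mul_add]; exact Nat.mul_le_mul_left _ (by omega)
    have h2 : 2 * (GR * e.2.1) ≤ e.1 * (2 * R) := by
      calc 2 * (GR * e.2.1) ≤ 2 * (e.1 * R) := Nat.mul_le_mul_left _ hGP
        _ = e.1 * (2 * R) := by ring
    have key : (g + A.1 + GR) * e.2.1 ≤ D * M * e.2.1 := by
      have e1 : 2 * (g + A.1) * e.2.1 = 2 * ((g + A.1) * e.2.1) := by ring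
      have e2 : 2 * D * M * e.2.1 = 2 * (D * M * e.2.1) := by ring
      rw [e1, e2] at ha
      rw [Nat.add_mul]
      omega
    exact Nat.le_of_mul_le_mul_right key hpP
  · exfalso; omega
  · simp only [c2B, Nat.ble_eq] at hb
    have h1 : e.1 * (3 * V + A.2.1) + e.1 * R ≤ e.1 * (3 * M) := by
      rw [← Nat.mul_add]; exact Nat.mul_le_mul_left _ (by omega)
    have key : (g + A.1 + GR) * e.2.1 ≤ D * M * e.2.1 := by
      rw [Nat.add_mul]
      omega
    exact Nat.le_of_mul_le_mul_right key hpP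
  · exfalso
    obtain ⟨h2V, hlt⟩ := hie
    have hcap := hE h2V
    generalize V * V / M + 3 * M = C at hlt hcap
    omega
  · simp only [c2E, Bool.and_eq_true, Nat.blt_eq, Nat.ble_eq] at hee
    obtain ⟨h2V, he⟩ := hee
    have hcap := hE h2V
    generalize hC : V * V / M + 3 * M = C at he hcap
    have hC4 : 4 * V + A.2.1 + R ≤ C := by omega
    have h1 : e.1 * (4 * V + A.2.1) + e.1 * R ≤ e.1 * C := by
      rw [← Nat.mul_add]; exact Nat.mul_le_mul_left _ hC4
    have key : (g + A.1 + GR) * e.2.1 ≤ D * M * e.2.1 := by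
      rw [Nat.add_mul]
      omega
    exact Nat.le_of_mul_le_mul_right key hpP

/-! ## The tree (Bool checkers; data passed as parameters) -/

section Tree

variable (tb : ℕ → ℕ) (m2 : ℕ → List (ℕ × ℕ × ℕ)) (gain : ℕ → ℕ) (row : ℕ → Entry)

/-- Case (i) of a node, canonically: the EARLIEST shape of the allowed list `ms` carried by a non-explicit member of the bucket is `m` — add it
(the child keeps the suffix from `m` on, so equal shapes may repeat) — for every position; shapes of volume `> V` cannot occur. [original] -/
def goI (V : ℕ) (child : Agg → List (ℕ × ℕ × ℕ) → Bool) (A : Agg) : List (ℕ × ℕ × ℕ) → Bool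
  | [] => true
  | m :: rest => (Nat.blt V (vol m) || child (addM (gain (vol m)) A m) (m :: rest)) && goI V child A rest

/-- **The tree** below the root (fuel `n`): node test at `t = TB[j]`, else case (i) over the allowed suffix `ms` (at most `kmax` explicit members)
AND case (ii) = descent to bucket `j − 1` with the complete list `M2[j−1]`. [original] -/
def treeK (g p V d al tl M kmax : ℕ) : ℕ → Agg → ℕ → List (ℕ × ℕ × ℕ) → Bool
  | 0, _, _, _ => false
  | n + 1, A, j, ms =>
    testK g p V d al tl A (tb j) (tb j) M (row j) false ||
      ((Nat.blt A.2.2.2.2.2 kmax && goI gain V (fun A' ms' => treeK g p V d al tl M kmax n A' j ms') A ms) &&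
        match j with
        | 0 => false
        | j' + 1 => treeK g p V d al tl M kmax n A j' (m2 j'))

/-- **The root** at bucket `j` (order `M`) for a maximal member whose own bucket is `j0 ≤ j`: root test (implicit source allowed), else case (i)
over the complete list `M2[j]` and — only when `j = j0` (at `j > j0` the member realising `t*` is a non-explicit companion in bucket `j`) —
case (ii). [original] -/
def rootK (g p V d al tl M kmax j j0 : ℕ) : Bool :=
  testK g p V d al tl agg0 (tb j) (tb j) M (row j) true ||
    (goI gain V (fun A' ms' => treeK tb m2 gain row g p V d al tl M kmax (kmax + j + 1) A' j ms') agg0 (m2 j) &&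
      (Nat.blt j0 j ||
        match j with
        | 0 => false
        | j' + 1 => treeK tb m2 gain row g p V d al tl M kmax (kmax + j + 1) agg0 j' (m2 j')))

/-- the tree cover of the orders `[L, H]` at bucket `j`: the root passes at every order -/
def coverK (g p V d al tl kmax j j0 L H : ℕ) : Bool :=
  (List.range (H + 1 - L)).all fun k => rootK tb m2 gain row g p V d al tl (L + k) kmax j j0

variable (tp : ℕ → ℕ)

/-- Walk the buckets `j, j+1, …` of a table row (dropped to index `j`) for a maximal member whose own bucket is `j0`: escape once `tiOK V (TB[j])`,
else the one-member `cover` at `t = TP[j]` or the tree cover `coverK` (which reads the full row `row`). [original] -/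
def walk3 (g p V d al tl kmax L H j0 : ℕ) : List Entry → ℕ → Bool
  | [], _ => true
  | e :: es, j => tiOK V (tb j) ||
      ((cover g p V d (tp j) L H e || coverK tb m2 gain row g p V d al tl kmax j j0 L H) && walk3 g p V d al tl kmax L H j0 es (j + 1))

/-- Soundness of the walk: if no bucket `j + k'`, `k' ≤ k`, escapes, then at bucket `j + k` the one-member `cover` passes at `t = TP[j+k]` or the
tree cover passes. [bookkeeping] -/
theorem walk3_sound (g p V d al tl kmax L H j0 : ℕ) : ∀ (es : List Entry) (j : ℕ),
    walk3 tb m2 gain row tp g p V d al tl kmax L H j0 es j = true →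
    ∀ k, k < es.length → (∀ k', k' ≤ k → tiOK V (tb (j + k')) = false) →
      cover g p V d (tp (j + k)) L H (es.getD k e0) = true ∨
        coverK tb m2 gain row g p V d al tl kmax (j + k) j0 L H = true
  | [], j, _, k, hk, _ => by simp at hk
  | e :: es, j, h, k, hk, hsmall => by
    have hunf : walk3 tb m2 gain row tp g p V d al tl kmax L H j0 (e :: es) j = (tiOK V (tb j) ||
        ((cover g p V d (tp j) L H e || coverK tb m2 gain row g p V d al tl kmax j j0 L H) &&
          walk3 tb m2 gain row tp g p V d al tl kmax L H j0 es (j + 1))) := rfl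
    rw [hunf, Bool.or_eq_true, Bool.and_eq_true, Bool.or_eq_true] at h
    rcases h with hstop | ⟨hc, hrest⟩
    · have h0 := hsmall 0 (Nat.zero_le _)
      simp only [Nat.add_zero] at h0
      rw [h0] at hstop
      exact absurd hstop Bool.false_ne_true
    · cases k with
      | zero => simpa using hc
      | succ k =>
        have hk' : k < es.length := by simpa using hk
        have := walk3_sound g p V d al tl kmax L H j0 es (j + 1) hrest k hk' (fun k' hk'' => by
          have := hsmall (k' + 1) (by omega)
          simpa [Nat.add_right_comm j 1 k', Nat.add_assoc] using this)
        simpa [Nat.add_right_comm j 1 k, Nat.add_assoc] using this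

/-- the tree cover at an order `M ∈ [L, H]` gives the root check at `M` [bookkeeping] -/
theorem coverK_at {g p V d al tl kmax j j0 L H M : ℕ} (h : coverK tb m2 gain row g p V d al tl kmax j j0 L H = true)
    (hLM : L ≤ M) (hMH : M ≤ H) : rootK tb m2 gain row g p V d al tl M kmax j j0 = true := by
  simp only [coverK, List.all_eq_true, List.mem_range] at h
  have := h (M - L) (by omega)
  rwa [show L + (M - L) = M by omega] at this

end Tree

end Summit.MatrixMultiplication.MatrixMultiplication.Theorems.TAStatKM
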